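import Literature.Combinatorics.LorentzianPolynomials.HodgeRiemannCubic
import Literature.Combinatorics.LorentzianPolynomials.MConvexMaps
import Literature.Combinatorics.LorentzianPolynomials.RayleighOperations
import HarnessLib

/-!
# Nonnegative directional derivatives preserve `L^d_n` (Brändén–Huh 2020, Cor. 2.11), the Hodge–Riemann
# relation for Lorentzian polynomials (Thm. 2.16 (2)) and, unconditionally, "every Lorentzian polynomial is
# `2(1 - 1/d)`-Rayleigh" (Prop. 2.19)

Layer `Literature/Combinatorics/LorentzianPolynomials`, namespace `Literature.Combinatorics.LorentzianPolynomials`;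
lane `lit-hodgefound` (Track 2 foundations library), seat p16, generation 28 (row g28-#4). Theorems only (no definition,
no named fact; net debt 0), for the tree's Definition-2.6 `lorentzian` (`Basic.lean`).

## Source (verbatim) — [BrandenHuh2019] P. Brändén, J. Huh, *Lorentzian polynomials*, Ann. of Math. 192 (2020),
## arXiv:1902.03719 (held `paper:arxiv-1902.03719`)

* §2.2 **Corollary 2.11.** "If `f ∈ L^d_n`, then `Σ_{i=1}^n a_i ∂_i f ∈ L^{d-1}_n` for any `a_1, …, a_n ≥ 0`."
* §2.3 **Theorem 2.16.** "Let `f` be a nonzero homogeneous polynomial in `ℝ[w_1, …, w_n]` of degree `d ≥ 2`. (1) If `f` is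
  in `L̊^d_n`, then `𝓗_f(w)` is nonsingular for all `w ∈ ℝ^n_{>0}`. (2) If `f` is in `L^d_n`, then `𝓗_f(w)` has exactly
  one positive eigenvalue for all `w ∈ ℝ^n_{>0}`." (proof: "for any nonzero polynomial `f` of degree `d ≥ 2` with
  nonnegative coefficients, `𝓗_f(w)` has at least one positive eigenvalue for any `w ∈ ℝ^n_{>0}`"); proof of Lemma 2.15:
  "Euler's formula for homogeneous functions: `d f = Σ_{i=1}^n w_i ∂_i f`. It follows that the Hessians of `f` and
  `∂_i f` satisfy the relation `(d-2) 𝓗_f = Σ_{i=1}^n w_i 𝓗_{∂_i f}`".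
* §2.4 **Proposition 2.19.** "Any polynomial in `L^d_n` is `2(1 - 1/d)`-Rayleigh." Proof: "The statement follows from
  Theorem 2.16 and Proposition 2.17 because `2(1 - 1/d)` is an increasing function of `d`."

## What is proved, and how (Brändén–Huh derive Cor. 2.11 from Thm. 2.10 and Thm. 2.16 from the homotopy Thm. 2.13;
## here both follow from the cubic Hodge–Riemann relation of `HodgeRiemannCubic`)

* §1 `iterPderiv_dirDeriv` (`∂^α D_a = D_a ∂^α`), `support_dirDeriv` (`supp D_a f = {β | β + e_k ∈ supp f, a_k ≠ 0}`).
* §2 **`dirDeriv_mem_lorentzian`** = Cor. 2.11: `f ∈ L^{d+1}_n`, `a ≥ 0` ⟹ `D_a f = Σ_k a_k ∂_k f ∈ L^d_n` — by the second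
  description of Def. 2.6 (`mem_lorentzian_iff_forall_sigPos_hessian`): the support is the union of lower shifts of
  `supp f` (`IsMConvex.lowerShifts`), and `∂^α D_a f = D_a (∂^α f)` with `∂^α f ∈ L³_n`, whose Hessian has at most one
  positive eigenvalue by `sigPos_hessian_dirDeriv_le_one`; iterates `iterate_dirDeriv_mem_lorentzian`,
  `foldr_dirDeriv_mem_lorentzian` (several nonnegative directions).
* §3 **`hessian_iterate_dirDeriv`**: `𝓗(D_w^m f) = m! · 𝓗_f(w)` for `f` homogeneous of degree `m + 2` (Euler's formula
  iterated: `D_w^m g = m! g(w)` for `g = ∂_i ∂_j f`), hence **`sigPos_hessianAt_le_one_of_mem_lorentzian`** = Thm. 2.16 (2)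
  on the CLOSED orthant: `f ∈ L^d_n`, `d ≥ 2`, `w ≥ 0` ⟹ `𝓗_f(w)` has at most one positive eigenvalue; with
  `one_le_sigPos` for `w > 0`, `f ≠ 0`: **`sigPos_hessianAt_eq_one_of_mem_lorentzian`** ("exactly one").
* §4 **`isCRayleigh_of_mem_lorentzian`** = Prop. 2.19 for every `f ∈ L^d_n` (the tree's conditional
  `isCRayleigh_of_mem_lorentzian_of_forall_sigPos_le_one` of `Rayleigh.lean` fed with §3).
* §5 (gen 28 addendum) the **Alexandrov–Fenchel-type inequality** carried by Thm. 2.16 (2): for `f ∈ L^d_n`, `w, y ∈ ℝ^n_{≥0}`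
  and any `x ∈ ℝ^n`, `(D_x D_x f)(w) · (D_y D_y f)(w) ≤ ((D_x D_y f)(w))²` (`eval_dirDeriv_dirDeriv`,
  **`dirDeriv_sq_ge_of_mem_lorentzian`**) — the reverse Cauchy–Schwarz inequality of a form with at most one positive
  eigenvalue (Shenfeld–van Handel Lemma 2.9, tree `mul_le_sq_of_sigPos_le_one`) for `𝓗_f(w)`, the mechanism of BH's
  Prop. 4.4 (`c_α² ≥ c_{α+e_i-e_j} c_{α-e_i+e_j}`, tree `normCoeff_sq_ge`) at a point `w` instead of at coefficients.
-/

noncomputable section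

open MvPolynomial Finsupp Finset Matrix
open scoped Nat
open Literature.LinearAlgebra.QuadraticForm

namespace Literature.Combinatorics.LorentzianPolynomials

variable {σ : Type*} [Fintype σ]

/-! ## §1 `D_a` commutes with `∂^α`; the support of `D_a f` -/

section Support

/-- `∂^α` of a finite sum. [cite: BrandenHuh2019, §2.1 (p. 8, `∂^α`)] -/
theorem iterPderiv_sum {ι : Type*} (α : σ →₀ ℕ) (s : Finset ι) (g : ι → MvPolynomial σ ℝ) :
    iterPderiv α (∑ k ∈ s, g k) = ∑ k ∈ s, iterPderiv α (g k) := by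
  classical
  induction s using Finset.induction_on with
  | empty => rw [Finset.sum_empty, Finset.sum_empty, iterPderiv_zero_right]
  | insert k s hk ih => rw [Finset.sum_insert hk, Finset.sum_insert hk, iterPderiv_add, ih]

/-- **`∂^α (D_a f) = D_a (∂^α f)`** (constant-coefficient differential operators commute).
[cite: BrandenHuh2019, §2.2 Cor. 2.11; §2.1 (p. 8, `∂^α`)] -/
theorem iterPderiv_dirDeriv (α : σ →₀ ℕ) (a : σ → ℝ) (f : MvPolynomial σ ℝ) :
    iterPderiv α (dirDeriv a f) = dirDeriv a (iterPderiv α f) := by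
  rw [dirDeriv, dirDeriv, iterPderiv_sum]
  refine Finset.sum_congr rfl fun k _ ↦ ?_
  rw [iterPderiv_smul, iterPderiv_pderiv, iterPderiv_add_single]

/-- `∂_i (D_a f) = D_a (∂_i f)`. [cite: BrandenHuh2019, §2.2 Cor. 2.11] -/
theorem pderiv_dirDeriv (i : σ) (a : σ → ℝ) (f : MvPolynomial σ ℝ) :
    pderiv i (dirDeriv a f) = dirDeriv a (pderiv i f) := by
  rw [dirDeriv, dirDeriv, map_sum]
  refine Finset.sum_congr rfl fun k _ ↦ ?_
  rw [(pderiv i).map_smul, pderiv_pderiv_comm]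

/-- **The support of `D_a f`** for `a ≥ 0` and `f` with nonnegative coefficients: `β ∈ supp D_a f` iff
`β + e_k ∈ supp f` for some `k` with `a_k ≠ 0` (no cancellation). [cite: BrandenHuh2019, §2.2 Cor. 2.11 (its `M^{d-1}_n`
part)] -/
theorem support_dirDeriv {a : σ → ℝ} (ha : ∀ k, 0 ≤ a k) {f : MvPolynomial σ ℝ} (hf : ∀ β, 0 ≤ coeff β f) :
    {β | coeff β (dirDeriv a f) ≠ 0} =
      {β : σ →₀ ℕ | ∃ k ∈ {k | a k ≠ 0}, β + Finsupp.single k 1 ∈ {α | coeff α f ≠ 0}} := by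
  ext β
  simp only [Set.mem_setOf_eq, coeff_dirDeriv]
  have hnn : ∀ k ∈ (Finset.univ : Finset σ), 0 ≤ a k * coeff β (pderiv k f) :=
    fun k _ ↦ mul_nonneg (ha k) (coeff_pderiv_nonneg hf k β)
  rw [ne_eq, Finset.sum_eq_zero_iff_of_nonneg hnn]
  push Not
  have hsupp : ∀ k, coeff β (pderiv k f) ≠ 0 ↔ coeff (β + Finsupp.single k 1) f ≠ 0 :=
    fun k ↦ Set.ext_iff.1 (support_pderiv_eq f k) β
  constructor
  · rintro ⟨k, -, hk⟩
    rcases mul_ne_zero_iff.1 hk with ⟨hak, hc⟩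
    exact ⟨k, hak, (hsupp k).1 hc⟩
  · rintro ⟨k, hak, hc⟩
    exact ⟨k, Finset.mem_univ _, mul_ne_zero hak ((hsupp k).2 hc)⟩

end Support

/-! ## §2 Corollary 2.11: nonnegative directional derivatives preserve `L^d_n` -/

section Cor211

variable [DecidableEq σ]

/-- **Brändén–Huh, Corollary 2.11: "If `f ∈ L^d_n`, then `Σ_{i=1}^n a_i ∂_i f ∈ L^{d-1}_n` for any `a_1, …, a_n ≥ 0`."**
For the tree's Definition-2.6 `lorentzian`, by the second description of Def. 2.6: `D_a f` is homogeneous with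
nonnegative coefficients, its support is the union of the lower shifts of `supp f` (M-convex by `IsMConvex.lowerShifts`),
and for `|α| = d - 3` the quadratic `∂^α D_a f = D_a (∂^α f)`, `∂^α f ∈ L³_n`, has at most one positive eigenvalue by the
cubic Hodge–Riemann relation `sigPos_hessian_dirDeriv_le_one`. [cite: BrandenHuh2019, §2.2 Cor. 2.11] -/
theorem dirDeriv_mem_lorentzian {a : σ → ℝ} (ha : ∀ k, 0 ≤ a k) :
    ∀ {d : ℕ} {f : MvPolynomial σ ℝ}, f ∈ lorentzian σ (d + 1) → dirDeriv a f ∈ lorentzian σ d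
  | 0, _, hf =>
    mem_lorentzian_zero.2 ⟨isHomogeneous_dirDeriv a (mem_lorentzian_one.1 hf).1,
      coeff_dirDeriv_nonneg ha (mem_lorentzian_one.1 hf).2⟩
  | 1, _, hf =>
    mem_lorentzian_one.2 ⟨isHomogeneous_dirDeriv a (mem_lorentzian_two.1 hf).1,
      coeff_dirDeriv_nonneg ha (mem_lorentzian_two.1 hf).2.1⟩
  | m + 2, f, hf => by
    have hhom := isHomogeneous_of_mem_lorentzian hf
    have hnn := coeff_nonneg_of_mem_lorentzian hf
    refine mem_lorentzian_iff_forall_sigPos_hessian.2 ⟨⟨isHomogeneous_dirDeriv a hhom, coeff_dirDeriv_nonneg ha hnn, ?_⟩,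
      fun α hα ↦ ?_⟩
    · rw [support_dirDeriv ha hnn]
      exact (isMConvex_support_of_mem_lorentzian hf).lowerShifts {k | a k ≠ 0}
    · rw [iterPderiv_dirDeriv]
      refine sigPos_hessian_dirDeriv_le_one (iterPderiv_mem_lorentzian ?_) ha
      rw [hα, show 3 + m = m + 2 + 1 by omega]
      exact hf

/-- **Iterated nonnegative directional derivatives**: `D_a^j f ∈ L^d_n` for `f ∈ L^{d+j}_n`, `a ≥ 0`.
[cite: BrandenHuh2019, §2.2 Cor. 2.11] -/
theorem iterate_dirDeriv_mem_lorentzian {a : σ → ℝ} (ha : ∀ k, 0 ≤ a k) :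
    ∀ (j : ℕ) {d : ℕ} {f : MvPolynomial σ ℝ}, f ∈ lorentzian σ (d + j) → (dirDeriv a)^[j] f ∈ lorentzian σ d
  | 0, _, _, hf => by simpa using hf
  | j + 1, d, f, hf => by
    rw [Function.iterate_succ_apply']
    exact dirDeriv_mem_lorentzian ha (iterate_dirDeriv_mem_lorentzian ha j (d := d + 1) (by rwa [add_assoc, add_comm 1]))

/-- **Several nonnegative directions**: `D_{a_1} ⋯ D_{a_j} f ∈ L^d_n` for `f ∈ L^{d+j}_n` and `a_1, …, a_j ≥ 0` (as a `foldr`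
over the list of directions). [cite: BrandenHuh2019, §2.2 Cor. 2.11] -/
theorem foldr_dirDeriv_mem_lorentzian :
    ∀ (l : List (σ → ℝ)), (∀ a ∈ l, ∀ k, 0 ≤ a k) → ∀ {d : ℕ} {f : MvPolynomial σ ℝ},
      f ∈ lorentzian σ (d + l.length) → l.foldr dirDeriv f ∈ lorentzian σ d
  | [], _, _, _, hf => by simpa using hf
  | a :: l, hl, d, f, hf => by
    rw [List.foldr_cons]
    refine dirDeriv_mem_lorentzian (hl a (by simp)) (foldr_dirDeriv_mem_lorentzian l ?_ (d := d + 1) ?_)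
    · exact fun b hb ↦ hl b (List.mem_cons_of_mem a hb)
    · rw [List.length_cons] at hf
      rwa [add_assoc, add_comm 1]

end Cor211

/-! ## §3 Theorem 2.16 (2): the Hessian of a Lorentzian polynomial has (at most / exactly) one positive eigenvalue -/

section HodgeRiemann

/-- `(D_w g)(w) = m · g(w)` for `g` homogeneous of degree `m` (Euler's formula). [cite: BrandenHuh2019, §2.3 proof of
Lemma 2.15 ("`d f = Σ w_i ∂_i f`")] -/
theorem eval_dirDeriv_self {g : MvPolynomial σ ℝ} {m : ℕ} (hg : g.IsHomogeneous m) (w : σ → ℝ) :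
    eval w (dirDeriv w g) = m * eval w g := by
  rw [dirDeriv, map_sum, ← sum_mul_eval_pderiv hg w]
  exact Finset.sum_congr rfl fun k _ ↦ by rw [smul_eq_C_mul, map_mul, eval_C]

/-- **Euler's formula iterated: `D_w^m g = m! · g(w)`** (a constant) for `g` homogeneous of degree `m`.
[cite: BrandenHuh2019, §2.3 proof of Lemma 2.15 (Euler's formula)] -/
theorem iterate_dirDeriv_eq_C :
    ∀ (m : ℕ) {g : MvPolynomial σ ℝ}, g.IsHomogeneous m → ∀ w : σ → ℝ, (dirDeriv w)^[m] g = C ((m ! : ℝ) * eval w g)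
  | 0, g, hg, w => by
    have hC : g = C (coeff 0 g) := totalDegree_eq_zero_iff_eq_C.1 (Nat.le_zero.1 hg.totalDegree_le)
    rw [Function.iterate_zero_apply, Nat.factorial_zero, Nat.cast_one, one_mul]
    conv_rhs => rw [hC, eval_C]
    exact hC
  | m + 1, g, hg, w => by
    rw [Function.iterate_succ_apply, iterate_dirDeriv_eq_C m (isHomogeneous_dirDeriv w hg) w, eval_dirDeriv_self hg,
      Nat.factorial_succ]
    push_cast
    ring_nf

/-- `∂_i` commutes with `D_a^m`. [cite: BrandenHuh2019, §2.2 Cor. 2.11] -/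
theorem pderiv_iterate_dirDeriv (i : σ) (a : σ → ℝ) :
    ∀ (m : ℕ) (f : MvPolynomial σ ℝ), pderiv i ((dirDeriv a)^[m] f) = (dirDeriv a)^[m] (pderiv i f)
  | 0, f => rfl
  | m + 1, f => by
    rw [Function.iterate_succ_apply, Function.iterate_succ_apply, ← pderiv_dirDeriv, pderiv_iterate_dirDeriv i a m]

/-- **`𝓗(D_w^m f) = m! · 𝓗_f(w)`** for `f` homogeneous of degree `m + 2`: the Hessian of `f` AT `w` is, up to `m!`, the
Hessian of the quadratic form `D_w^m f` ("`(d-2) 𝓗_f = Σ_i w_i 𝓗_{∂_i f}`", iterated). [cite: BrandenHuh2019, §2.3 proof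
of Lemma 2.15] -/
theorem hessian_iterate_dirDeriv {f : MvPolynomial σ ℝ} {m : ℕ} (hf : f.IsHomogeneous (m + 2)) (w : σ → ℝ) :
    hessian ((dirDeriv w)^[m] f) = (m ! : ℝ) • hessianAt f w := by
  ext i j
  rw [hessian_apply, Matrix.smul_apply, hessianAt_apply, smul_eq_mul, pderiv_iterate_dirDeriv, pderiv_iterate_dirDeriv]
  have hij : (pderiv i (pderiv j f)).IsHomogeneous m := by
    simpa using (hf.pderiv (i := j)).pderiv (i := i)
  rw [iterate_dirDeriv_eq_C m hij w, coeff_zero_C]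

variable [DecidableEq σ]

/-- **Brändén–Huh, Theorem 2.16 (2), on the closed orthant**: if `f ∈ L^d_n` (`d = m + 2 ≥ 2`) and `w ∈ ℝ^n_{≥0}`, then the
Hessian `𝓗_f(w)` has AT MOST one positive eigenvalue (`sigPos ≤ 1`). Proof: `D_w^m f ∈ L²_n` by Cor. 2.11 iterated, and
`𝓗(D_w^m f) = m! 𝓗_f(w)`. [cite: BrandenHuh2019, §2.3 Thm. 2.16 (2)] -/
theorem sigPos_hessianAt_le_one_of_mem_lorentzian {m : ℕ} {f : MvPolynomial σ ℝ} (hf : f ∈ lorentzian σ (m + 2))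
    {w : σ → ℝ} (hw : ∀ k, 0 ≤ w k) : sigPos (Matrix.toBilin' (hessianAt f w)).toQuadraticMap ≤ 1 := by
  have h2 : (dirDeriv w)^[m] f ∈ lorentzian σ 2 := iterate_dirDeriv_mem_lorentzian hw m (by rwa [add_comm])
  have hsig := (mem_lorentzian_two.1 h2).2.2.2
  rw [hessian_iterate_dirDeriv (isHomogeneous_of_mem_lorentzian hf) w, map_smul,
    sigPos_smul_of_pos _ (by exact_mod_cast Nat.factorial_pos m)] at hsig
  exact hsig

/-- Theorem 2.16 (2) with the degree hypothesis `2 ≤ d`. [cite: BrandenHuh2019, §2.3 Thm. 2.16 (2)] -/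
theorem sigPos_hessianAt_le_one_of_mem_lorentzian' {d : ℕ} {f : MvPolynomial σ ℝ} (hf : f ∈ lorentzian σ d)
    (hd : 2 ≤ d) {w : σ → ℝ} (hw : ∀ k, 0 ≤ w k) : sigPos (Matrix.toBilin' (hessianAt f w)).toQuadraticMap ≤ 1 := by
  obtain ⟨m, rfl⟩ : ∃ m, d = m + 2 := ⟨d - 2, by omega⟩
  exact sigPos_hessianAt_le_one_of_mem_lorentzian hf hw

/-- **Brändén–Huh, Theorem 2.16 (2): "If `f` is in `L^d_n`, then `𝓗_f(w)` has exactly one positive eigenvalue for all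
`w ∈ ℝ^n_{>0}`"** (`f` nonzero of degree `d ≥ 2`; `sigPos = 1`): at most one by the previous theorem, at least one since
`wᵀ 𝓗_f(w) w = d(d-1) f(w) > 0`. [cite: BrandenHuh2019, §2.3 Thm. 2.16 (2) and its proof ("`𝓗_f(w)` has at least one
positive eigenvalue for any `w ∈ ℝ^n_{>0}`")] -/
theorem sigPos_hessianAt_eq_one_of_mem_lorentzian {d : ℕ} {f : MvPolynomial σ ℝ} (hf : f ∈ lorentzian σ d)
    (hd : 2 ≤ d) (hf0 : f ≠ 0) {w : σ → ℝ} (hw : ∀ k, 0 < w k) :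
    sigPos (Matrix.toBilin' (hessianAt f w)).toQuadraticMap = 1 := by
  refine le_antisymm (sigPos_hessianAt_le_one_of_mem_lorentzian' hf hd fun k ↦ (hw k).le) ?_
  refine one_le_sigPos_of_self_pos (Matrix.toBilin' (hessianAt f w)) (w := w) ?_
  rw [toBilin'_hessianAt_self (isHomogeneous_of_mem_lorentzian hf) w]
  have h1 : (0 : ℝ) < d := by exact_mod_cast (by omega : 0 < d)
  have h2 : (0 : ℝ) < ((d - 1 : ℕ) : ℝ) := by exact_mod_cast (by omega : 0 < d - 1)
  exact mul_pos (mul_pos h1 h2) (eval_pos_of_coeff_nonneg (coeff_nonneg_of_mem_lorentzian hf) hf0 hw)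

/-- Thm. 2.16 (2) for all the derivatives `∂^α f`, `|α| ≤ d - 2`, of an `f ∈ L^d_n` — the hypothesis of the tree's
conditional Prop. 2.19 (`isCRayleigh_of_mem_lorentzian_of_forall_sigPos_le_one`). [cite: BrandenHuh2019, §2.3
Thm. 2.16 (2); §2.4 proof of Prop. 2.19] -/
theorem sigPos_hessianAt_iterPderiv_le_one_of_mem_lorentzian {d : ℕ} {f : MvPolynomial σ ℝ} (hf : f ∈ lorentzian σ d)
    {α : σ →₀ ℕ} (hα : α.degree + 2 ≤ d) {w : σ → ℝ} (hw : ∀ k, 0 ≤ w k) :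
    sigPos (Matrix.toBilin' (hessianAt (iterPderiv α f) w)).toQuadraticMap ≤ 1 := by
  obtain ⟨m, hm⟩ : ∃ m, d = (m + 2) + α.degree := ⟨d - 2 - α.degree, by omega⟩
  rw [hm] at hf
  exact sigPos_hessianAt_le_one_of_mem_lorentzian (iterPderiv_mem_lorentzian hf) hw

end HodgeRiemann

/-! ## §4 Proposition 2.19: every Lorentzian polynomial is `2(1 - 1/d)`-Rayleigh -/

section Rayleigh

variable [DecidableEq σ]

/-- **Brändén–Huh, Proposition 2.19: "Any polynomial in `L^d_n` is `2(1 - 1/d)`-Rayleigh."** — i.e.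
`∂^α f(w) · ∂^{α+e_i+e_j} f(w) ≤ 2(1 - 1/d) · ∂^{α+e_i} f(w) · ∂^{α+e_j} f(w)` for all `i, j`, `α ∈ ℕ^n`, `w ∈ ℝ^n_{≥0}`
(Def. 2.18). "The statement follows from Theorem 2.16 and Proposition 2.17 because `2(1 - 1/d)` is an increasing
function of `d`": the tree's `isCRayleigh_of_mem_lorentzian_of_forall_sigPos_le_one` (Prop. 2.17 + monotonicity) fed with
Thm. 2.16 (2) for the `∂^α f`. [cite: BrandenHuh2019, §2.4 Prop. 2.19] -/
theorem isCRayleigh_of_mem_lorentzian {d : ℕ} {f : MvPolynomial σ ℝ} (hf : f ∈ lorentzian σ d) :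
    IsCRayleigh (2 * (1 - 1 / (d : ℝ))) f :=
  isCRayleigh_of_mem_lorentzian_of_forall_sigPos_le_one hf fun _ hα _ hw ↦
    sigPos_hessianAt_iterPderiv_le_one_of_mem_lorentzian hf hα fun k ↦ (hw k).le

/-- **Every Lorentzian polynomial is `2`-Rayleigh** (`2(1 - 1/d) ≤ 2`; the degree-free form used for matroids in §4.3).
[cite: BrandenHuh2019, §2.4 Prop. 2.19; §4.3 (p. 50, "is `2(1 - 1/d)`-Rayleigh, hence `2`-Rayleigh")] -/
theorem isCRayleigh_two_of_mem_lorentzian {d : ℕ} {f : MvPolynomial σ ℝ} (hf : f ∈ lorentzian σ d) :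
    IsCRayleigh 2 f := by
  refine (isCRayleigh_of_mem_lorentzian hf).mono ?_
  rcases Nat.eq_zero_or_pos d with hd | hd
  · subst hd; norm_num
  · have h : (0 : ℝ) ≤ 1 / (d : ℝ) := by positivity
    linarith

end Rayleigh

/-! ## §5 The Alexandrov–Fenchel-type inequality at a point -/

section AlexandrovFenchel

variable [DecidableEq σ]

/-- `(D_a D_b f)(w) = aᵀ 𝓗_f(w) b`. [cite: BrandenHuh2019, §2.5 (the operators `D_i = Σ_j a_{ij} ∂_j`); §4.1 Prop. 4.5
("`v_i^T 𝓗 v_j = D_i D_j D_3 ⋯ D_d f`")] -/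
theorem eval_dirDeriv_dirDeriv (a b : σ → ℝ) (f : MvPolynomial σ ℝ) (w : σ → ℝ) :
    eval w (dirDeriv a (dirDeriv b f)) = Matrix.toBilin' (hessianAt f w) a b := by
  have hev : ∀ (c : σ → ℝ) (g : MvPolynomial σ ℝ), eval w (dirDeriv c g) = ∑ k, c k * eval w (pderiv k g) := by
    intro c g
    rw [dirDeriv, map_sum]
    exact Finset.sum_congr rfl fun k _ ↦ by rw [smul_eq_C_mul, map_mul, eval_C]
  rw [toBilin'_hessianAt_apply, hev]
  refine Finset.sum_congr rfl fun i _ ↦ ?_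
  rw [pderiv_dirDeriv, hev, Finset.mul_sum]
  refine Finset.sum_congr rfl fun j _ ↦ ?_
  rw [hessianAt_apply, pderiv_pderiv_comm]
  ring

/-- `yᵀ 𝓗_f(w) z ≥ 0` for `y, z, w ∈ ℝ^n_{≥0}` when `f` has nonnegative coefficients. [cite: BrandenHuh2019, §2.3 proof of
Thm. 2.16 ("`𝓗_f(w)` has at least one positive eigenvalue for any `w ∈ ℝ^n_{>0}`")] -/
theorem toBilin'_hessianAt_nonneg {f : MvPolynomial σ ℝ} (hnn : ∀ α, 0 ≤ coeff α f) {w y z : σ → ℝ} (hw : ∀ k, 0 ≤ w k)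
    (hy : ∀ k, 0 ≤ y k) (hz : ∀ k, 0 ≤ z k) : 0 ≤ Matrix.toBilin' (hessianAt f w) y z := by
  rw [toBilin'_hessianAt_apply]
  exact Finset.sum_nonneg fun i _ ↦ Finset.sum_nonneg fun j _ ↦
    mul_nonneg (mul_nonneg (hessianAt_nonneg hnn hw i j) (hy i)) (hz j)

/-- **Alexandrov–Fenchel-type inequality for Lorentzian polynomials (bilinear form)**: for `f ∈ L^d_n`, `w, y ∈ ℝ^n_{≥0}`
and any `x ∈ ℝ^n`, `(xᵀ𝓗_f(w)x)(yᵀ𝓗_f(w)y) ≤ (xᵀ𝓗_f(w)y)²` — since `𝓗_f(w)` has at most one positive eigenvalue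
(Thm. 2.16 (2)) and `yᵀ𝓗_f(w)y ≥ 0`. [cite: BrandenHuh2019, §2.3 Thm. 2.16 (2); §4.1 (the Alexandrov–Fenchel inequality
`V(C_1,C_2,…)² ≥ V(C_1,C_1,…)V(C_2,C_2,…)` and Prop. 4.4)] [cite: ShenfeldVanHandel2019, §2.4 Lemma 2.9 (3) ⇒ (1)] -/
theorem toBilin'_hessianAt_sq_ge_of_mem_lorentzian {d : ℕ} {f : MvPolynomial σ ℝ} (hf : f ∈ lorentzian σ d) {w : σ → ℝ}
    (hw : ∀ k, 0 ≤ w k) (x : σ → ℝ) {y : σ → ℝ} (hy : ∀ k, 0 ≤ y k) :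
    Matrix.toBilin' (hessianAt f w) x x * Matrix.toBilin' (hessianAt f w) y y ≤ (Matrix.toBilin' (hessianAt f w) x y) ^ 2 := by
  rcases Nat.lt_or_ge d 2 with hd | hd
  · -- degree `≤ 1`: the Hessian vanishes
    have h0 : hessianAt f w = 0 := by
      ext i j
      rw [hessianAt_apply, Matrix.zero_apply, ← iterPderiv_single_add_single,
        iterPderiv_eq_zero_of_lt (isHomogeneous_of_mem_lorentzian hf)
          (by rw [map_add, Finsupp.degree_single, Finsupp.degree_single]; omega), map_zero]
    simp [h0]
  · exact Literature.LinearAlgebra.QuadraticForm.mul_le_sq_of_sigPos_le_one (Matrix.toBilin' (hessianAt f w))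
      (isSymm_toBilin'_hessianAt f w) (sigPos_hessianAt_le_one_of_mem_lorentzian' hf hd hw) x y
      (toBilin'_hessianAt_nonneg (coeff_nonneg_of_mem_lorentzian hf) hw hy hy)

/-- **Alexandrov–Fenchel-type inequality for Lorentzian polynomials (mixed directional derivatives)**: for `f ∈ L^d_n`,
`w, y ∈ ℝ^n_{≥0}` and any `x ∈ ℝ^n`, `(D_x D_x f)(w) · (D_y D_y f)(w) ≤ ((D_x D_y f)(w))²` — the analog, for the "mixed
form" `(x, y) ↦ D_x D_y f(w)`, of `V(C_1,C_1,…) V(C_2,C_2,…) ≤ V(C_1,C_2,…)²`. [cite: BrandenHuh2019, §2.3 Thm. 2.16 (2)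
("an analog of the Hodge–Riemann relation"); §4.1 (Alexandrov–Fenchel inequality, Prop. 4.4)]
[cite: ShenfeldVanHandel2019, §2.4 Lemma 2.9] -/
theorem dirDeriv_sq_ge_of_mem_lorentzian {d : ℕ} {f : MvPolynomial σ ℝ} (hf : f ∈ lorentzian σ d) {w : σ → ℝ}
    (hw : ∀ k, 0 ≤ w k) (x : σ → ℝ) {y : σ → ℝ} (hy : ∀ k, 0 ≤ y k) :
    eval w (dirDeriv x (dirDeriv x f)) * eval w (dirDeriv y (dirDeriv y f)) ≤ (eval w (dirDeriv x (dirDeriv y f))) ^ 2 := by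
  rw [eval_dirDeriv_dirDeriv, eval_dirDeriv_dirDeriv, eval_dirDeriv_dirDeriv]
  exact toBilin'_hessianAt_sq_ge_of_mem_lorentzian hf hw x hy

end AlexandrovFenchel

end Literature.Combinatorics.LorentzianPolynomials

end
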